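import Summits.AtomisticToContinuum.Crystallization.Theorems.FreeSplittingCertificatesStrictSplittingRuleCoreFirstOrderDesignGeometry

/-!
# `StrictSplittingRule` (stmt-AtomisticToContinuum-12560): moments of the relaxed hcp first shell

Route `FreeSplittingCertificates`, crux r3 `StrictSplittingRule`, line `registered` (unit b2b-freesplit-B, gen 6).
Third brick of the far lemma of the H12⋆ architecture (HOME CERT.md §14 (3)), after
`…StrictSplittingRuleGroundStateHardy.lean` (discrete Hardy from a supersolution) and `…StrictSplittingRuleHardyProfile.lean`
(moment form of the supersolution margin of the quadratic profile `φ = ‖y‖²` against `r⁻⁶` bond weights): the margin at a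
site `x` is a polynomial in the MOMENTS of `δ_s = 2⟪y_x, e_s⟫ + ‖e_s‖²` over the twelve bond vectors `e_s` of the first
shell of `x`.  For the relaxed hcp crystal `hcpSite a h : ℤ³ → ℝ³` (in-layer spacing `a`, layer spacing `h`) the bond
vectors at an even-layer site are `y_s = hcpSite a h s`, `s ∈ hcpStarIdx` (`h1_sub_of_even`), and at an odd-layer site
their negatives (`h1_sub_of_odd`; the odd-site stencil is `−hcpStarIdx`), so all moments are those of the ROOT SHELL
`{y_s : s ∈ hcpStarIdx}` up to the sign of the odd ones.  This file computes them in closed form: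

* `hcpShell_sum_expand` — the twelve-term expansion of `Σ_{s ∈ hcpStarIdx}`;
* `hcpShell_norm_sq` — `‖y_s‖² = a²` for the six in-layer labels, `a²/3 + h²` for the six off-layer ones;
* `hcpShell_sum_inner`, `hcpShell_sum_eq_zero` — first moment `Σ_s y_s = 0`;
* `hcpShell_second_moment_inLayer / _offLayer / hcpShell_second_moment` — `Σ_s ⟪z, y_s⟫² = 4a²(z₀² + z₁²) + 6h² z₂²`
  (in-layer part `3a²(z₀²+z₁²)`, off-layer part `a²(z₀²+z₁²) + 6h² z₂²`; isotropic `= 4a²‖z‖²` exactly at the ideal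
  ratio `h² = 2a²/3`);
* `hcpShell_sum_norm_sq_mul_inner` — `Σ_s ‖y_s‖² ⟪z, y_s⟫ = 0` (each sub-shell is balanced);
* `hcpShell_third_moment`, `hcpShell_third_moment_sq_le` — `Σ_s ⟪z, y_s⟫³ = (√3/6) a³ (3 z₀² z₁ − z₁³)` (only the two
  off-layer triangles contribute; the shell is not centrosymmetric) and `(Σ_s ⟪z, y_s⟫³)² ≤ (a⁶/12)(z₀² + z₁²)³`;
* `hcpShell_sum_norm_sq`, `hcpShell_sum_norm_pow_four` — `Σ‖y_s‖² = 8a² + 6h²`, `Σ‖y_s‖⁴ = 6a⁴ + 6(a²/3 + h²)²`;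
* `hcpShell_delta_sum`, `hcpShell_delta_sq_sum` — hence for `δ_s = 2⟪z, y_s⟫ + ‖y_s‖²`:
  `Σ_s δ_s = 8a² + 6h²` and `Σ_s δ_s² = 16a²(z₀²+z₁²) + 24h² z₂² + 6a⁴ + 6(a²/3+h²)²`.

Structural bookkeeping ([folklore]: elementary coordinates of the hcp contact shell); VALUE = a kernel-checked brick of
the far lemma — NOT summit progress.
-/

noncomputable section

namespace Summit.AtomisticToContinuum.Crystallization.Theorems.StrictSplittingRuleBirth

open scoped BigOperators
open Literature.MathematicalPhysics.StatisticalMechanics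
open Summit.AtomisticToContinuum.Crystallization.Theorems.PalmUnimodularRigidity.LayeredLawsSelectHcp
open Summit.AtomisticToContinuum.Crystallization.Theorems.PhononStabilityCWC.Cert (inner_fin3)

/-- **Twelve-term expansion** of a sum over the shell labels. [folklore] -/
theorem hcpShell_sum_expand {M : Type*} [AddCommMonoid M] (f : ℤ × ℤ × ℤ → M) :
    ∑ s ∈ hcpStarIdx, f s =
      f (0, 1, 0) + (f (0, -1, 0) + (f (0, 0, 1) + (f (0, 0, -1) + (f (0, 1, -1) + (f (0, -1, 1) +
        (f (1, 0, 0) + (f (1, -1, 0) + (f (1, 0, -1) + (f (-1, 0, 0) + (f (-1, -1, 0) + f (-1, 0, -1))))))))))) := by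
  rw [hcpStarIdx]
  repeat rw [Finset.sum_insert (by decide)]
  rw [Finset.sum_singleton]

/-- Letters of the three layers met by the shell: `L(0) = 0`, `L(1) = L(−1) = 1`. [folklore] -/
theorem hcpShell_labels :
    haggLabel alternatingHagg 0 = 0 ∧ haggLabel alternatingHagg 1 = 1 ∧ haggLabel alternatingHagg (-1) = 1 :=
  ⟨haggLabel_alternating_of_even (by decide), haggLabel_alternating_of_odd (by decide),
    haggLabel_alternating_of_odd (by decide)⟩

/-- **Inner products with the twelve shell vectors**, coordinate form. [folklore] -/
theorem hcpShell_inner (a h : ℝ) (z : EuclideanSpace ℝ (Fin 3)) :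
    inner ℝ z (hcpSite a h (0, 1, 0)) = a * z 0 ∧
    inner ℝ z (hcpSite a h (0, -1, 0)) = -(a * z 0) ∧
    inner ℝ z (hcpSite a h (0, 0, 1)) = a / 2 * z 0 + a * √3 / 2 * z 1 ∧
    inner ℝ z (hcpSite a h (0, 0, -1)) = -(a / 2 * z 0 + a * √3 / 2 * z 1) ∧
    inner ℝ z (hcpSite a h (0, 1, -1)) = a / 2 * z 0 - a * √3 / 2 * z 1 ∧
    inner ℝ z (hcpSite a h (0, -1, 1)) = -(a / 2 * z 0 - a * √3 / 2 * z 1) ∧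
    inner ℝ z (hcpSite a h (1, 0, 0)) = a / 2 * z 0 + a * √3 / 6 * z 1 + h * z 2 ∧
    inner ℝ z (hcpSite a h (1, -1, 0)) = -(a / 2) * z 0 + a * √3 / 6 * z 1 + h * z 2 ∧
    inner ℝ z (hcpSite a h (1, 0, -1)) = -(a * √3 / 3) * z 1 + h * z 2 ∧
    inner ℝ z (hcpSite a h (-1, 0, 0)) = a / 2 * z 0 + a * √3 / 6 * z 1 - h * z 2 ∧
    inner ℝ z (hcpSite a h (-1, -1, 0)) = -(a / 2) * z 0 + a * √3 / 6 * z 1 - h * z 2 ∧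
    inner ℝ z (hcpSite a h (-1, 0, -1)) = -(a * √3 / 3) * z 1 - h * z 2 := by
  obtain ⟨l0, l1, lm1⟩ := hcpShell_labels
  simp only [inner_fin3, hcpSite_apply_zero, hcpSite_apply_one, hcpSite_apply_two, l0, l1, lm1]
  push_cast
  refine ⟨?_, ?_, ?_, ?_, ?_, ?_, ?_, ?_, ?_, ?_, ?_, ?_⟩ <;> ring

/-- **Squared lengths**: `a²` for the six in-layer struts, `a²/3 + h²` for the six off-layer ones. [folklore] -/
theorem hcpShell_norm_sq (a h : ℝ) {s : ℤ × ℤ × ℤ} (hs : s ∈ hcpStarIdx) :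
    ‖hcpSite a h s‖ ^ 2 = if s.1 = 0 then a ^ 2 else a ^ 2 / 3 + h ^ 2 := by
  obtain ⟨l0, l1, lm1⟩ := hcpShell_labels
  have h3 : (√3 : ℝ) ^ 2 = 3 := Real.sq_sqrt (by norm_num)
  simp only [hcpStarIdx, Finset.mem_insert, Finset.mem_singleton] at hs
  rcases hs with rfl | rfl | rfl | rfl | rfl | rfl | rfl | rfl | rfl | rfl | rfl | rfl <;>
    simp only [norm_sq_eq_three, hcpSite_apply_zero, hcpSite_apply_one, hcpSite_apply_two, l0, l1, lm1] <;>
    push_cast <;> simp <;> nlinarith [h3]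

/-- **First moment, scalar form**: `Σ_s ⟪z, y_s⟫ = 0`. [folklore] -/
theorem hcpShell_sum_inner (a h : ℝ) (z : EuclideanSpace ℝ (Fin 3)) :
    ∑ s ∈ hcpStarIdx, inner ℝ z (hcpSite a h s) = 0 := by
  obtain ⟨e1, e2, e3, e4, e5, e6, e7, e8, e9, e10, e11, e12⟩ := hcpShell_inner a h z
  rw [hcpShell_sum_expand, e1, e2, e3, e4, e5, e6, e7, e8, e9, e10, e11, e12]
  ring

/-- **First moment**: `Σ_s y_s = 0`. [folklore] -/
theorem hcpShell_sum_eq_zero (a h : ℝ) : ∑ s ∈ hcpStarIdx, hcpSite a h s = 0 := by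
  have hz : ∀ z : EuclideanSpace ℝ (Fin 3), inner ℝ z (∑ s ∈ hcpStarIdx, hcpSite a h s) = 0 := fun z => by
    rw [inner_sum]; exact hcpShell_sum_inner a h z
  have := hz (∑ s ∈ hcpStarIdx, hcpSite a h s)
  rwa [real_inner_self_eq_norm_sq, sq_eq_zero_iff, norm_eq_zero] at this

/-- **Second moment of the in-layer hexagon**: `Σ_{in-layer s} ⟪z, y_s⟫² = 3a²(z₀² + z₁²)`. [folklore] -/
theorem hcpShell_second_moment_inLayer (a h : ℝ) (z : EuclideanSpace ℝ (Fin 3)) :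
    inner ℝ z (hcpSite a h (0, 1, 0)) ^ 2 + inner ℝ z (hcpSite a h (0, -1, 0)) ^ 2 +
      inner ℝ z (hcpSite a h (0, 0, 1)) ^ 2 + inner ℝ z (hcpSite a h (0, 0, -1)) ^ 2 +
      inner ℝ z (hcpSite a h (0, 1, -1)) ^ 2 + inner ℝ z (hcpSite a h (0, -1, 1)) ^ 2 =
      3 * a ^ 2 * (z 0 ^ 2 + z 1 ^ 2) := by
  obtain ⟨e1, e2, e3, e4, e5, e6, -, -, -, -, -, -⟩ := hcpShell_inner a h z
  have h3 : (√3 : ℝ) ^ 2 = 3 := Real.sq_sqrt (by norm_num)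
  rw [e1, e2, e3, e4, e5, e6]
  linear_combination (a ^ 2 * z 1 ^ 2) * h3

/-- **Second moment of the two off-layer triangles**: `Σ_{off-layer s} ⟪z, y_s⟫² = a²(z₀² + z₁²) + 6h² z₂²`. [folklore] -/
theorem hcpShell_second_moment_offLayer (a h : ℝ) (z : EuclideanSpace ℝ (Fin 3)) :
    inner ℝ z (hcpSite a h (1, 0, 0)) ^ 2 + inner ℝ z (hcpSite a h (1, -1, 0)) ^ 2 +
      inner ℝ z (hcpSite a h (1, 0, -1)) ^ 2 + inner ℝ z (hcpSite a h (-1, 0, 0)) ^ 2 +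
      inner ℝ z (hcpSite a h (-1, -1, 0)) ^ 2 + inner ℝ z (hcpSite a h (-1, 0, -1)) ^ 2 =
      a ^ 2 * (z 0 ^ 2 + z 1 ^ 2) + 6 * h ^ 2 * z 2 ^ 2 := by
  obtain ⟨-, -, -, -, -, -, e7, e8, e9, e10, e11, e12⟩ := hcpShell_inner a h z
  have h3 : (√3 : ℝ) ^ 2 = 3 := Real.sq_sqrt (by norm_num)
  rw [e7, e8, e9, e10, e11, e12]
  linear_combination (a ^ 2 * z 1 ^ 2 / 3) * h3

/-- **Second moment of the shell**: `Σ_s ⟪z, y_s⟫² = 4a²(z₀² + z₁²) + 6h² z₂²` (`= 4a²‖z‖²` at the ideal ratio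
`h² = 2a²/3`). [folklore] -/
theorem hcpShell_second_moment (a h : ℝ) (z : EuclideanSpace ℝ (Fin 3)) :
    ∑ s ∈ hcpStarIdx, inner ℝ z (hcpSite a h s) ^ 2 = 4 * a ^ 2 * (z 0 ^ 2 + z 1 ^ 2) + 6 * h ^ 2 * z 2 ^ 2 := by
  have hin := hcpShell_second_moment_inLayer a h z
  have hoff := hcpShell_second_moment_offLayer a h z
  rw [hcpShell_sum_expand]
  linarith

/-- **The weighted first moment vanishes**: `Σ_s ‖y_s‖² ⟪z, y_s⟫ = 0` (the in-layer hexagon and the two off-layer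
triangles are separately balanced). [folklore] -/
theorem hcpShell_sum_norm_sq_mul_inner (a h : ℝ) (z : EuclideanSpace ℝ (Fin 3)) :
    ∑ s ∈ hcpStarIdx, ‖hcpSite a h s‖ ^ 2 * inner ℝ z (hcpSite a h s) = 0 := by
  obtain ⟨e1, e2, e3, e4, e5, e6, e7, e8, e9, e10, e11, e12⟩ := hcpShell_inner a h z
  have hn : ∀ s ∈ hcpStarIdx, ‖hcpSite a h s‖ ^ 2 * inner ℝ z (hcpSite a h s) =
      (if s.1 = 0 then a ^ 2 else a ^ 2 / 3 + h ^ 2) * inner ℝ z (hcpSite a h s) := fun s hs => by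
    rw [hcpShell_norm_sq a h hs]
  rw [Finset.sum_congr rfl hn, hcpShell_sum_expand, e1, e2, e3, e4, e5, e6, e7, e8, e9, e10, e11, e12]
  norm_num
  ring

/-- **Third moment**: only the off-layer triangles contribute, `Σ_s ⟪z, y_s⟫³ = (√3/6) a³ (3 z₀² z₁ − z₁³)`
(the shell is not centrosymmetric). [folklore] -/
theorem hcpShell_third_moment (a h : ℝ) (z : EuclideanSpace ℝ (Fin 3)) :
    ∑ s ∈ hcpStarIdx, inner ℝ z (hcpSite a h s) ^ 3 = √3 / 6 * a ^ 3 * (3 * z 0 ^ 2 * z 1 - z 1 ^ 3) := by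
  obtain ⟨e1, e2, e3, e4, e5, e6, e7, e8, e9, e10, e11, e12⟩ := hcpShell_inner a h z
  have h3 : (√3 : ℝ) ^ 2 = 3 := Real.sq_sqrt (by norm_num)
  rw [hcpShell_sum_expand, e1, e2, e3, e4, e5, e6, e7, e8, e9, e10, e11, e12]
  linear_combination (-(√3 * a ^ 3 * z 1 ^ 3 / 18)) * h3

/-- **Third-moment bound**: `(Σ_s ⟪z, y_s⟫³)² ≤ (a⁶/12)(z₀² + z₁²)³` (from
`(3z₀²z₁ − z₁³)² + (z₀³ − 3z₀z₁²)² = (z₀² + z₁²)³`). [folklore] -/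
theorem hcpShell_third_moment_sq_le (a h : ℝ) (z : EuclideanSpace ℝ (Fin 3)) :
    (∑ s ∈ hcpStarIdx, inner ℝ z (hcpSite a h s) ^ 3) ^ 2 ≤ a ^ 6 / 12 * (z 0 ^ 2 + z 1 ^ 2) ^ 3 := by
  rw [hcpShell_third_moment]
  have h3 : (√3 : ℝ) ^ 2 = 3 := Real.sq_sqrt (by norm_num)
  have hid : (3 * z 0 ^ 2 * z 1 - z 1 ^ 3) ^ 2 + (z 0 ^ 3 - 3 * z 0 * z 1 ^ 2) ^ 2 = (z 0 ^ 2 + z 1 ^ 2) ^ 3 := by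
    ring
  have hsq : (√3 / 6 * a ^ 3 * (3 * z 0 ^ 2 * z 1 - z 1 ^ 3)) ^ 2 =
      a ^ 6 / 12 * (3 * z 0 ^ 2 * z 1 - z 1 ^ 3) ^ 2 := by
    linear_combination (a ^ 6 * (3 * z 0 ^ 2 * z 1 - z 1 ^ 3) ^ 2 / 36) * h3
  rw [hsq]
  have ha : 0 ≤ a ^ 6 / 12 := by positivity
  nlinarith [sq_nonneg (z 0 ^ 3 - 3 * z 0 * z 1 ^ 2), mul_nonneg ha (sq_nonneg (z 0 ^ 3 - 3 * z 0 * z 1 ^ 2))]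

/-- `Σ_s ‖y_s‖² = 8a² + 6h²`. [folklore] -/
theorem hcpShell_sum_norm_sq (a h : ℝ) : ∑ s ∈ hcpStarIdx, ‖hcpSite a h s‖ ^ 2 = 8 * a ^ 2 + 6 * h ^ 2 := by
  rw [Finset.sum_congr rfl fun s hs => hcpShell_norm_sq a h hs, hcpShell_sum_expand]
  norm_num
  ring

/-- `Σ_s ‖y_s‖⁴ = 6a⁴ + 6(a²/3 + h²)²`. [folklore] -/
theorem hcpShell_sum_norm_pow_four (a h : ℝ) :
    ∑ s ∈ hcpStarIdx, ‖hcpSite a h s‖ ^ 4 = 6 * a ^ 4 + 6 * (a ^ 2 / 3 + h ^ 2) ^ 2 := by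
  have hn : ∀ s ∈ hcpStarIdx, ‖hcpSite a h s‖ ^ 4 = (if s.1 = 0 then a ^ 2 else a ^ 2 / 3 + h ^ 2) ^ 2 :=
    fun s hs => by rw [← hcpShell_norm_sq a h hs]; ring
  rw [Finset.sum_congr rfl hn, hcpShell_sum_expand]
  norm_num
  ring

/-- **Moments of `δ`**: for `δ_s = 2⟪z, y_s⟫ + ‖y_s‖²` (the exact difference `‖z + y_s‖² − ‖z‖²` of the quadratic
profile), `Σ_s δ_s = 8a² + 6h²`. [folklore] -/
theorem hcpShell_delta_sum (a h : ℝ) (z : EuclideanSpace ℝ (Fin 3)) :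
    ∑ s ∈ hcpStarIdx, (2 * inner ℝ z (hcpSite a h s) + ‖hcpSite a h s‖ ^ 2) = 8 * a ^ 2 + 6 * h ^ 2 := by
  rw [Finset.sum_add_distrib, ← Finset.mul_sum, hcpShell_sum_inner, hcpShell_sum_norm_sq]
  ring

/-- … and `Σ_s δ_s² = 16a²(z₀² + z₁²) + 24h² z₂² + 6a⁴ + 6(a²/3 + h²)²`. [folklore] -/
theorem hcpShell_delta_sq_sum (a h : ℝ) (z : EuclideanSpace ℝ (Fin 3)) :
    ∑ s ∈ hcpStarIdx, (2 * inner ℝ z (hcpSite a h s) + ‖hcpSite a h s‖ ^ 2) ^ 2 =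
      16 * a ^ 2 * (z 0 ^ 2 + z 1 ^ 2) + 24 * h ^ 2 * z 2 ^ 2 + 6 * a ^ 4 + 6 * (a ^ 2 / 3 + h ^ 2) ^ 2 := by
  have hx : ∀ s ∈ hcpStarIdx, (2 * inner ℝ z (hcpSite a h s) + ‖hcpSite a h s‖ ^ 2) ^ 2 =
      4 * inner ℝ z (hcpSite a h s) ^ 2 + 4 * (‖hcpSite a h s‖ ^ 2 * inner ℝ z (hcpSite a h s)) +
        ‖hcpSite a h s‖ ^ 4 := fun s _ => by ring
  rw [Finset.sum_congr rfl hx, Finset.sum_add_distrib, Finset.sum_add_distrib, ← Finset.mul_sum, ← Finset.mul_sum,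
    hcpShell_second_moment, hcpShell_sum_norm_sq_mul_inner, hcpShell_sum_norm_pow_four]
  ring

end Summit.AtomisticToContinuum.Crystallization.Theorems.StrictSplittingRuleBirth

end
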